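import Literature.NumberTheory.PAdicHodge.AinfTopology
import HarnessLib

/-!
# Fontaine's limit `[u] = lim φⁿ(ûₙ)` in `𝔸_inf(F)` for a contracting endomorphism `φ` of `𝔫 = θ⁻¹(𝔪_{ℂ_F})`

Topic `Literature/NumberTheory/PAdicHodge`; sequel of `AinfTopology`. The construction underlying the
Teichmüller representative `[x] = lim x̂ₙ^{pⁿ}` (`φ = (·)^p`), Fontaine's element `[ε]` and `t = log[ε]`, and the
`p`-adic periods of a formal group `𝔉` (`φ = [p]_𝔉`; Fontaine, *Groupes p-divisibles sur les corps locaux*,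
Astérisque 47–48 (1977) Ch. V §1; Colmez, *Périodes p-adiques des variétés abéliennes*, Math. Ann. 292
(1992) §2; Fontaine 1994 Exp. II §1.2 for `φ = x ↦ x^p`), made ABSTRACT: let `φ : 𝔫 → 𝔫` be a self-map of
the nil ideal `𝔫 ⊂ 𝔸_inf(F)` which is **contracting** for the `(p, ξ)`-adic filtration,

  `a ≡ b (mod (p,ξ)^{n+1}) ⇒ φ(a) ≡ φ(b) (mod (p,ξ)^{n+2})`      (`IsContracting φ`)

(for `φ = [p]_𝔉` this is `[p](X) = pX f(X) + g(X^p)`, AEC IV.4.4; proved for formal groups in the sequel),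
and let `u : ℕ → 𝔫` satisfy `φ(u_{n+1}) ≡ u_n (mod (p, ξ))` — e.g. lifts `ûₙ` of a `φ`-compatible sequence
in `𝔪_{ℂ_F}` (`θ(φ ûₙ₊₁) = θ(ûₙ)`, `sub_mem_ideal_of_theta_eq`). Then:

* `iterate_sub_iterate_mem` — `φⁿ` improves congruences by `n` steps;
* `approx φ u n = φⁿ(u n)` is Cauchy: `approx (n+1) − approx n ∈ (p,ξ)^{n+1}` (`approx_succ_sub_approx_mem`);
* **`flim φ u`** — its limit (`𝔸_inf` is `(p,ξ)`-adically complete, tree `isAdicComplete_span_p_xi`), with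
  `flim − approx n ∈ (p,ξ)^{n+1}` (`flim_sub_approx_mem`), uniquely determined (`eq_flim_of_forall_sub_mem`),
  `Tendsto (approx φ u) atTop (𝓝 flim)` (`tendsto_approx_flim`);
* **independence of the lifts**: `uₙ ≡ u'ₙ (mod (p,ξ))` for all `n` ⇒ `flim u = flim u'` (`flim_congr`);
* **`θ(flim) = 0`** when `θ(φⁿ(uₙ)) = 0` for all `n` (`theta_flim_eq_zero`; e.g. `[pⁿ]uₙ = u₀ = 0` in `𝔉(𝔪_{ℂ_F})`),
  by continuity of `θ` (`AinfTop.continuous_theta`);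
* **equivariance** (`map_flim`): a continuous map `s : 𝔸_inf → 𝔸_inf` restricting to a self-map of `𝔫` that
  commutes with `φ` (e.g. `σ ∈ Γ_F`, `AinfTop.continuous_gal`) satisfies `s(flim u) = flim (s ∘ u)`.

Definitions (reviewed): `IsContracting`, `approx`, `flim`. No named facts, no `sorry`. Infrastructure for the
supersingular sector of hDR (periods of formal groups); nothing about elliptic curves is proved here.

## References
* J.-M. Fontaine, *Le corps des périodes p-adiques*, Astérisque 223 (1994), Exp. II §1.2.1–1.2.2
  (`[x] = lim x̂ₙ^{pⁿ}`, `θ`). [FontaineAsterisque223III]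
* J.-M. Fontaine, Y. Ouyang, *Theory of p-adic Galois representations*, §4.4. [FontaineOuyang2022]
* J. H. Silverman, *The Arithmetic of Elliptic Curves* (2009), IV.4.4 (`[p](X) = p f(X) + g(X^p)`). [SilvermanAEC2009]
-/

noncomputable section

open Ideal Filter Topology Field WittVector

namespace Literature.NumberTheory.PAdicHodge

open Literature.NumberTheory.GaloisRepresentations
open Literature.NumberTheory.GaloisRepresentations.IsNonarchimedeanLocalField
open Literature.NumberTheory.GaloisRepresentations.LubinTate

namespace AinfTop

variable {F : Type} [Field F] [ValuativeRel F] [TopologicalSpace F] [IsNonarchimedeanLocalField F]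
  {p : ℕ} [Fact p.Prime] [Fact (¬ IsUnit (p : integerC F))]
  [IsAdicComplete (Ideal.span {(p : integerC F)}) (integerC F)] [CharZero F]
  {hθ : Function.Surjective (fontaineTheta (integerC F) p)}

/-! ## §1 Convergence tools in `AinfTop` -/

omit [IsAdicComplete (Ideal.span {(p : integerC F)}) (integerC F)] [CharZero F] in
/-- A sequence with `L − f n ∈ (p,ξ)^{n+1}` tends to `L`. [cite: FontaineAsterisque223III, Exp. II §1.3.1] -/
theorem tendsto_of_forall_sub_mem_pow {f : ℕ → AinfTop F p} {L : AinfTop F p}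
    (h : ∀ n, L - f n ∈ (WithIdeal.i ^ (n + 1) : Ideal (AinfTop F p))) : Tendsto f atTop (𝓝 L) := by
  rw [(Ideal.hasBasis_nhds_adic (WithIdeal.i : Ideal (AinfTop F p)) L).tendsto_right_iff]
  intro m _
  rw [Filter.eventually_atTop]
  refine ⟨m, fun n hn => ⟨f n - L, ?_, by abel⟩⟩
  have h1 : f n - L = -(L - f n) := by abel
  rw [SetLike.mem_coe, h1]
  exact Submodule.neg_mem _ (Ideal.pow_le_pow_right (by omega) (h n))

/-- **Completeness in membership form**: a sequence with `f(n+1) − f(n) ∈ (p,ξ)^{n+1}` has a limit `L` with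
`L − f(n) ∈ (p,ξ)^{n+1}`. [cite: FontaineAsterisque223III, Exp. II §1.3.2] -/
theorem exists_lim_of_forall_sub_mem_pow_succ {f : ℕ → AinfTop F p}
    (hf : ∀ n, f (n + 1) - f n ∈ (WithIdeal.i ^ (n + 1) : Ideal (AinfTop F p))) :
    ∃ L : AinfTop F p, ∀ n, L - f n ∈ (WithIdeal.i ^ (n + 1) : Ideal (AinfTop F p)) := by
  haveI : IsAdicComplete (WithIdeal.i : Ideal (AinfTop F p)) (AinfTop F p) :=
    isAdicComplete_span_p_xi (F := F) (p := p)
  -- shift the sequence by one so that the tree's membership-form completeness applies with exponent `n + 1`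
  obtain ⟨L, hL⟩ := Literature.RingTheory.AdicTopology.AdicPair.exists_lim_of_forall_sub_mem
    (I := (WithIdeal.i : Ideal (AinfTop F p))) (fun n => f (n - 1)) fun n => by
      rcases n with _ | n
      · simp
      · simpa using hf n
  exact ⟨L, fun n => by simpa using hL (n + 1)⟩

/-- Uniqueness of such limits (`𝔸_inf` is `(p,ξ)`-adically separated). [cite: FontaineAsterisque223III, Exp. II §1.3.2] -/
theorem eq_of_forall_sub_mem_pow {L L' : AinfTop F p}
    (h : ∀ n, L - L' ∈ (WithIdeal.i ^ (n + 1) : Ideal (AinfTop F p))) : L = L' := by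
  haveI : IsAdicComplete (WithIdeal.i : Ideal (AinfTop F p)) (AinfTop F p) :=
    isAdicComplete_span_p_xi (F := F) (p := p)
  refine sub_eq_zero.1 (IsHausdorff.haus (IsAdicComplete.toIsHausdorff (I := (WithIdeal.i : Ideal (AinfTop F p))))
    _ fun n => ?_)
  rw [smul_eq_mul, Ideal.mul_top, SModEq.zero]
  exact Ideal.pow_le_pow_right (Nat.le_succ n) (h n)

/-- `θ(a) = θ(b) ⇒ a ≡ b (mod (p, ξ))` (`ker θ = ξ𝔸_inf ⊆ (p, ξ)`). [cite: FontaineAsterisque223III, Exp. II §1.2.2] -/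
theorem sub_mem_ideal_of_theta_eq {a b : AinfTop F p} (h : theta F p a = theta F p b) :
    a - b ∈ (WithIdeal.i : Ideal (AinfTop F p)) := by
  have hker : (of F p).symm (a - b) ∈ RingHom.ker (fontaineTheta (integerC F) p) := by
    rw [RingHom.mem_ker]
    have h' : theta F p (a - b) = 0 := by rw [map_sub, h, sub_self]
    have h'' := congrArg (fun z : CBall F => (z : CompletedAlgClosure F)) h'
    simp only [ZeroMemClass.coe_zero] at h''
    exact Subtype.ext h''
  rw [ker_fontaineTheta_eq_span_xi, Ideal.mem_span_singleton'] at hker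
  obtain ⟨c, hc⟩ := hker
  rw [ideal_eq]
  have : a - b = of F p c * of F p xi := by rw [← map_mul, hc]; rfl
  rw [this]
  exact Ideal.mul_mem_left _ _ (Ideal.subset_span (by simp))

/-! ## §2 Contracting self-maps of `𝔫` and Fontaine's limit -/

variable (hθ) in
/-- **A contracting self-map of `𝔫`**: `a ≡ b (mod (p,ξ)^{n+1}) ⇒ φ a ≡ φ b (mod (p,ξ)^{n+2})` for all `n`.
For `φ = [p]_𝔉` on the points of a formal group this is Silverman's `[p](X) = p f(X) + g(X^p)` (AEC IV.4.4);
for `φ = (·)^p` it is the binomial congruence behind `[x] = lim x̂ₙ^{pⁿ}`.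
[cite: FontaineAsterisque223III, Exp. II §1.2.1] [cite: SilvermanAEC2009, IV.4.4] -/
def IsContracting (φ : (nilTheta F p hθ).toIdeal → (nilTheta F p hθ).toIdeal) : Prop :=
  ∀ (n : ℕ) (a b : (nilTheta F p hθ).toIdeal),
    (a : AinfTop F p) - b ∈ (WithIdeal.i ^ (n + 1) : Ideal (AinfTop F p)) →
      (φ a : AinfTop F p) - φ b ∈ (WithIdeal.i ^ (n + 2) : Ideal (AinfTop F p))

variable {φ : (nilTheta F p hθ).toIdeal → (nilTheta F p hθ).toIdeal}

/-- Iterating a contracting map improves a congruence by one step per iteration: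
`a ≡ b (mod (p,ξ)^{k+1}) ⇒ φⁿ a ≡ φⁿ b (mod (p,ξ)^{n+k+1})`. [cite: FontaineAsterisque223III, Exp. II §1.2.1] -/
theorem iterate_sub_iterate_mem (hφ : IsContracting hθ φ) (n : ℕ) :
    ∀ (k : ℕ) (a b : (nilTheta F p hθ).toIdeal),
      (a : AinfTop F p) - b ∈ (WithIdeal.i ^ (k + 1) : Ideal (AinfTop F p)) →
        ((φ^[n] a : (nilTheta F p hθ).toIdeal) : AinfTop F p) - (φ^[n] b : (nilTheta F p hθ).toIdeal) ∈
          (WithIdeal.i ^ (n + k + 1) : Ideal (AinfTop F p)) := by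
  induction n with
  | zero => intro k a b h; simpa using h
  | succ n ih =>
    intro k a b h
    rw [Function.iterate_succ_apply', Function.iterate_succ_apply']
    have h1 := hφ (n + k) _ _ (ih k a b h)
    simpa [show n + k + 2 = n + 1 + k + 1 by ring] using h1

variable (φ) in
/-- **The `n`-th approximant `φⁿ(uₙ)`** of Fontaine's limit. [cite: FontaineAsterisque223III, Exp. II §1.2.1] -/
def approx (u : ℕ → (nilTheta F p hθ).toIdeal) (n : ℕ) : AinfTop F p := ((φ^[n] (u n) : (nilTheta F p hθ).toIdeal) : AinfTop F p)

/-- Unfolding `approx`. [cite: FontaineAsterisque223III, Exp. II §1.2.1] -/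
theorem approx_def (u : ℕ → (nilTheta F p hθ).toIdeal) (n : ℕ) :
    approx φ u n = ((φ^[n] (u n) : (nilTheta F p hθ).toIdeal) : AinfTop F p) := rfl

/-- **The approximants are Cauchy**: if `φ(u_{n+1}) ≡ u_n (mod (p,ξ))` for all `n` then
`φ^{n+1}(u_{n+1}) − φⁿ(u_n) ∈ (p,ξ)^{n+1}`. [cite: FontaineAsterisque223III, Exp. II §1.2.1] -/
theorem approx_succ_sub_approx_mem (hφ : IsContracting hθ φ) {u : ℕ → (nilTheta F p hθ).toIdeal}
    (hu : ∀ n, ((φ (u (n + 1)) : (nilTheta F p hθ).toIdeal) : AinfTop F p) - u n ∈ (WithIdeal.i : Ideal (AinfTop F p)))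
    (n : ℕ) : approx φ u (n + 1) - approx φ u n ∈ (WithIdeal.i ^ (n + 1) : Ideal (AinfTop F p)) := by
  rw [approx_def, approx_def, Function.iterate_succ_apply]
  have h := iterate_sub_iterate_mem hφ n 0 (φ (u (n + 1))) (u n) (by rw [zero_add, pow_one]; exact hu n)
  simpa using h

/-- Existence of the limit. [cite: FontaineAsterisque223III, Exp. II §1.2.1] -/
theorem exists_flim (hφ : IsContracting hθ φ) {u : ℕ → (nilTheta F p hθ).toIdeal}
    (hu : ∀ n, ((φ (u (n + 1)) : (nilTheta F p hθ).toIdeal) : AinfTop F p) - u n ∈ (WithIdeal.i : Ideal (AinfTop F p))) :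
    ∃ L : AinfTop F p, ∀ n, L - approx φ u n ∈ (WithIdeal.i ^ (n + 1) : Ideal (AinfTop F p)) :=
  exists_lim_of_forall_sub_mem_pow_succ (approx_succ_sub_approx_mem hφ hu)

/-- **Fontaine's limit `[u]_φ = lim φⁿ(uₙ)`** for a contracting `φ` and a sequence `u` with
`φ(u_{n+1}) ≡ u_n (mod (p, ξ))`. [cite: FontaineAsterisque223III, Exp. II §1.2.1] -/
def flim (hφ : IsContracting hθ φ) (u : ℕ → (nilTheta F p hθ).toIdeal)
    (hu : ∀ n, ((φ (u (n + 1)) : (nilTheta F p hθ).toIdeal) : AinfTop F p) - u n ∈ (WithIdeal.i : Ideal (AinfTop F p))) :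
    AinfTop F p :=
  Classical.choose (exists_flim hφ hu)

/-- `[u]_φ − φⁿ(uₙ) ∈ (p,ξ)^{n+1}`. [cite: FontaineAsterisque223III, Exp. II §1.2.1] -/
theorem flim_sub_approx_mem (hφ : IsContracting hθ φ) {u : ℕ → (nilTheta F p hθ).toIdeal}
    (hu : ∀ n, ((φ (u (n + 1)) : (nilTheta F p hθ).toIdeal) : AinfTop F p) - u n ∈ (WithIdeal.i : Ideal (AinfTop F p)))
    (n : ℕ) : flim hφ u hu - approx φ u n ∈ (WithIdeal.i ^ (n + 1) : Ideal (AinfTop F p)) :=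
  Classical.choose_spec (exists_flim hφ hu) n

/-- The approximants converge to `[u]_φ`. [cite: FontaineAsterisque223III, Exp. II §1.2.1] -/
theorem tendsto_approx_flim (hφ : IsContracting hθ φ) {u : ℕ → (nilTheta F p hθ).toIdeal}
    (hu : ∀ n, ((φ (u (n + 1)) : (nilTheta F p hθ).toIdeal) : AinfTop F p) - u n ∈ (WithIdeal.i : Ideal (AinfTop F p))) :
    Tendsto (approx φ u) atTop (𝓝 (flim hφ u hu)) :=
  tendsto_of_forall_sub_mem_pow (flim_sub_approx_mem hφ hu)

/-- **Characterisation**: any `L` with `L − φⁿ(uₙ) ∈ (p,ξ)^{n+1}` for all `n` is `[u]_φ`.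
[cite: FontaineAsterisque223III, Exp. II §1.2.1] -/
theorem eq_flim_of_forall_sub_mem (hφ : IsContracting hθ φ) {u : ℕ → (nilTheta F p hθ).toIdeal}
    (hu : ∀ n, ((φ (u (n + 1)) : (nilTheta F p hθ).toIdeal) : AinfTop F p) - u n ∈ (WithIdeal.i : Ideal (AinfTop F p)))
    {L : AinfTop F p} (hL : ∀ n, L - approx φ u n ∈ (WithIdeal.i ^ (n + 1) : Ideal (AinfTop F p))) :
    L = flim hφ u hu :=
  eq_of_forall_sub_mem_pow fun n => by
    have : L - flim hφ u hu = (L - approx φ u n) - (flim hφ u hu - approx φ u n) := by ring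
    rw [this]
    exact Submodule.sub_mem _ (hL n) (flim_sub_approx_mem hφ hu n)

/-- **Independence of the lifts**: if `uₙ ≡ u'ₙ (mod (p,ξ))` for all `n` (e.g. `θ(uₙ) = θ(u'ₙ)`) then
`[u]_φ = [u']_φ`. [cite: FontaineAsterisque223III, Exp. II §1.2.1] -/
theorem flim_congr (hφ : IsContracting hθ φ) {u u' : ℕ → (nilTheta F p hθ).toIdeal}
    (hu : ∀ n, ((φ (u (n + 1)) : (nilTheta F p hθ).toIdeal) : AinfTop F p) - u n ∈ (WithIdeal.i : Ideal (AinfTop F p)))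
    (hu' : ∀ n, ((φ (u' (n + 1)) : (nilTheta F p hθ).toIdeal) : AinfTop F p) - u' n ∈ (WithIdeal.i : Ideal (AinfTop F p)))
    (h : ∀ n, ((u n : (nilTheta F p hθ).toIdeal) : AinfTop F p) - u' n ∈ (WithIdeal.i : Ideal (AinfTop F p))) :
    flim hφ u hu = flim hφ u' hu' := by
  refine eq_flim_of_forall_sub_mem hφ hu' fun n => ?_
  have h1 : approx φ u n - approx φ u' n ∈ (WithIdeal.i ^ (n + 1) : Ideal (AinfTop F p)) := by
    rw [approx_def, approx_def]
    have h2 := iterate_sub_iterate_mem hφ n 0 (u n) (u' n) (by rw [zero_add, pow_one]; exact h n)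
    simpa using h2
  have : flim hφ u hu - approx φ u' n = (flim hφ u hu - approx φ u n) + (approx φ u n - approx φ u' n) := by ring
  rw [this]
  exact Submodule.add_mem _ (flim_sub_approx_mem hφ hu n) h1

/-- **`θ([u]_φ) = 0`** as soon as `θ(φⁿ(uₙ)) = 0` for all `n` (for `φ = [p]_𝔉` and lifts of a `p`-power
compatible sequence of torsion points: `[pⁿ]uₙ = u₀ = 0`); by continuity of `θ`.
[cite: FontaineAsterisque223III, Exp. II §1.2.2] -/
theorem theta_flim_eq_zero (hφ : IsContracting hθ φ) {u : ℕ → (nilTheta F p hθ).toIdeal}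
    (hu : ∀ n, ((φ (u (n + 1)) : (nilTheta F p hθ).toIdeal) : AinfTop F p) - u n ∈ (WithIdeal.i : Ideal (AinfTop F p)))
    (h0 : ∀ n, theta F p (approx φ u n) = 0) : theta F p (flim hφ u hu) = 0 := by
  have h1 : Tendsto (fun n => theta F p (approx φ u n)) atTop (𝓝 (theta F p (flim hφ u hu))) :=
    ((continuous_theta (F := F) (p := p)).tendsto (flim hφ u hu)).comp (tendsto_approx_flim hφ hu)
  have h2 : (fun n => theta F p (approx φ u n)) = fun _ => 0 := funext h0
  rw [h2] at h1
  exact (tendsto_nhds_unique tendsto_const_nhds h1).symm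

/-- **Equivariance of Fontaine's limit**: a continuous map `s` of `𝔸_inf` restricting to a self-map `s𝔫` of `𝔫`
that commutes with `φ` (e.g. `σ ∈ Γ_F`, tree `AinfTop.continuous_gal`, `gal_mem_nilTheta`) satisfies
`s([u]_φ) = [s ∘ u]_φ` (`su = s𝔫 ∘ u`). [cite: FontaineAsterisque223III, Exp. II §1.2.2] -/
theorem map_flim (hφ : IsContracting hθ φ) {s : AinfTop F p → AinfTop F p} (hs : Continuous s)
    (s𝔫 : (nilTheta F p hθ).toIdeal → (nilTheta F p hθ).toIdeal)
    (hs𝔫 : ∀ a : (nilTheta F p hθ).toIdeal, ((s𝔫 a : (nilTheta F p hθ).toIdeal) : AinfTop F p) = s a)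
    (hsφ : ∀ a : (nilTheta F p hθ).toIdeal, s𝔫 (φ a) = φ (s𝔫 a))
    {u su : ℕ → (nilTheta F p hθ).toIdeal} (hsu_def : ∀ n, su n = s𝔫 (u n))
    (hu : ∀ n, ((φ (u (n + 1)) : (nilTheta F p hθ).toIdeal) : AinfTop F p) - u n ∈ (WithIdeal.i : Ideal (AinfTop F p)))
    (hsu : ∀ n, ((φ (su (n + 1)) : (nilTheta F p hθ).toIdeal) : AinfTop F p) - su n ∈ (WithIdeal.i : Ideal (AinfTop F p))) :
    s (flim hφ u hu) = flim hφ su hsu := by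
  -- `s` commutes with the iterates of `φ`
  have hiter : ∀ (n : ℕ) (a : (nilTheta F p hθ).toIdeal), s𝔫 (φ^[n] a) = φ^[n] (s𝔫 a) := by
    intro n
    induction n with
    | zero => intro a; rfl
    | succ n ih => intro a; rw [Function.iterate_succ_apply, Function.iterate_succ_apply, ← hsφ, ih]
  have h1 : Tendsto (fun n => s (approx φ u n)) atTop (𝓝 (s (flim hφ u hu))) :=
    (hs.tendsto (flim hφ u hu)).comp (tendsto_approx_flim hφ hu)
  have h2 : (fun n => s (approx φ u n)) = approx φ su := by
    funext n
    rw [approx_def, approx_def, ← hs𝔫, hiter, hsu_def]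
  rw [h2] at h1
  exact tendsto_nhds_unique h1 (tendsto_approx_flim hφ hsu)

end AinfTop

end Literature.NumberTheory.PAdicHodge

end
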